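import Summits.PneNP.PneNP.Theorems.OneSliceConstantBandTransferStepAux
import Literature.Computability.Complexity.RossmanMonotoneCliqueProofs

/-!
# Route OneSlice, item `ShallowSliceBound` (stmt-PneNP-14083): window bookkeeping for the forcing step

Helper file (prover seat, 2026-08-16), def-free. Elementary facts for **Leg A** (`…Forcing.lean`):

* `forcing_window` — for `k ≥ 3`, eventually in `n`, every central `j` (`|j - m_k(n)| ≤ m_k(n)^{3/4}`,
  `m_k(n) = ⌊C(n,2) n^{-2/(k-1)}⌋₊`) satisfies `2C(k,2) + 2 ≤ j`, `4j ≤ C(n,2)`, `j ≤ 2 C(n,2) n^{-2/(k-1)}` and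
  `C(n,2) n^{-2/(k-1)} ≤ 8 (j - C(k,2))` (adapted from `window_eventually` of the crux skeleton
  `Cruxes/ConstantBand/Lines/sharpness-sandwich.lean`);
* `choose_add_mul_pow_le` — `C(N, a+K) a^K ≤ C(N, a) N^K` (ratio of slice sizes);
* `forcing_tail_eventually` — the sprinkle tail `8 n^{2θ} n^{-2δ₁/(k-1)} ≤ ε` eventually, for `θ = δ₁/(2(k-1))`.
-/

set_option linter.dupNamespace false

noncomputable section

namespace Summit.PneNP.PneNP.Theorems.ShallowSliceBound

open Finset Filter Literature.Computability.Complexity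
open Summit.PneNP.PneNP.Theorems.ConstantBand.Negative (Edge thr Central slice)
open scoped Topology

/-- `M^{3/4} ≤ M/2` for `M ≥ 16`. [folklore] -/
theorem rpow_three_quarters_le_half' {M : ℝ} (hM : 16 ≤ M) : M ^ ((3 : ℝ) / 4) ≤ M / 2 := by
  -- adapted from Cruxes/ConstantBand/Lines/sharpness-sandwich.lean (`rpow_three_quarters_le_half`)
  have hM0 : 0 < M := by linarith
  have h1 : M ^ ((3 : ℝ) / 4) = M * M ^ (-(1 : ℝ) / 4) := by
    rw [show (3 : ℝ) / 4 = 1 + -(1 : ℝ) / 4 by norm_num, Real.rpow_add hM0, Real.rpow_one]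
  have h2 : M ^ (-(1 : ℝ) / 4) ≤ (16 : ℝ) ^ (-(1 : ℝ) / 4) :=
    Real.rpow_le_rpow_of_nonpos (by norm_num) hM (by norm_num)
  have h3 : (16 : ℝ) ^ (-(1 : ℝ) / 4) = 1 / 2 := by
    have h16 : (16 : ℝ) = (2 : ℝ) ^ (4 : ℝ) := by
      rw [show (4 : ℝ) = ((4 : ℕ) : ℝ) by norm_num, Real.rpow_natCast]; norm_num
    rw [h16, ← Real.rpow_mul (by norm_num : (0 : ℝ) ≤ 2),
      show (4 : ℝ) * (-(1 : ℝ) / 4) = -1 by norm_num, Real.rpow_neg_one]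
    norm_num
  rw [h1]
  calc M * M ^ (-(1 : ℝ) / 4) ≤ M * (1 / 2) := by
        rw [← h3]; exact mul_le_mul_of_nonneg_left h2 hM0.le
    _ = M / 2 := by ring

/-- **The window package for the forcing step**: for `k ≥ 3`, eventually in `n`, `C(n,2) > 0`, `2k ≤ n`, and every
central `j` satisfies `2 C(k,2) + 2 ≤ j`, `4 j ≤ C(n,2)`, `j ≤ 2 · C(n,2) n^{-2/(k-1)}` and
`C(n,2) n^{-2/(k-1)} ≤ 8 (j - C(k,2))`. [folklore] -/
theorem forcing_window {k : ℕ} (hk : 3 ≤ k) :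
    ∀ᶠ n : ℕ in atTop, 0 < n.choose 2 ∧ 2 * k ≤ n ∧ ∀ j : ℕ, Central k n j →
      2 * k.choose 2 + 2 ≤ j ∧ 4 * j ≤ n.choose 2 ∧
      (j : ℝ) ≤ 2 * (((n.choose 2 : ℕ) : ℝ) * (n : ℝ) ^ (-(2 : ℝ) / ((k : ℝ) - 1))) ∧
      ((n.choose 2 : ℕ) : ℝ) * (n : ℝ) ^ (-(2 : ℝ) / ((k : ℝ) - 1)) ≤ 8 * ((j : ℝ) - k.choose 2) := by
  -- adapted from Cruxes/ConstantBand/Lines/sharpness-sandwich.lean (`window_eventually`)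
  have hk1 : (2 : ℝ) ≤ (k : ℝ) - 1 := by
    have : (3 : ℝ) ≤ k := by exact_mod_cast hk
    linarith
  have hαpos : 0 < (2 : ℝ) / ((k : ℝ) - 1) := div_pos two_pos (by linarith)
  have hr : Tendsto (fun n : ℕ => (n : ℝ) ^ (-(2 : ℝ) / ((k : ℝ) - 1))) atTop (𝓝 0) :=
    tendsto_rpow_threshold (k := k) (by omega)
  have hT := Summit.PneNP.PneNP.Cruxes.ConstantBand.FlatPriorRelativeMinterms.ts_tendsto_T hk
  set K := k.choose 2 with hK
  filter_upwards [hr.eventually (gt_mem_nhds (by norm_num : (0 : ℝ) < 1 / 6)),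
    hT.eventually_ge_atTop ((4 * K + 20 : ℕ) : ℝ), eventually_ge_atTop (max (2 * k) 2)] with n hn6 hTn hn
  have hn2 : 2 ≤ n := (le_max_right _ _).trans hn
  have hN : 0 < n.choose 2 := Nat.choose_pos hn2
  refine ⟨hN, (le_max_left _ _).trans hn, fun j hj => ?_⟩
  set T : ℝ := ((n.choose 2 : ℕ) : ℝ) * (n : ℝ) ^ (-(2 : ℝ) / ((k : ℝ) - 1)) with hTdef
  have hNr : (0 : ℝ) < ((n.choose 2 : ℕ) : ℝ) := by exact_mod_cast hN
  have hr0 : 0 ≤ (n : ℝ) ^ (-(2 : ℝ) / ((k : ℝ) - 1)) := Real.rpow_nonneg (Nat.cast_nonneg _) _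
  have hT0 : 0 ≤ T := mul_nonneg hNr.le hr0
  have hm_le : (thr k n : ℝ) ≤ T := Nat.floor_le hT0
  have hm_ge : T - 1 < (thr k n : ℝ) := Nat.sub_one_lt_floor _
  have hTK : ((4 * K + 20 : ℕ) : ℝ) ≤ T := hTn
  push_cast at hTK
  have hm16 : (16 : ℝ) ≤ (thr k n : ℝ) := by linarith
  have h34 := rpow_three_quarters_le_half' hm16
  obtain ⟨hj1, hj2⟩ := abs_sub_le_iff.1 hj
  have hjlo : (thr k n : ℝ) / 2 ≤ j := by linarith
  have hjhi : (j : ℝ) ≤ 3 * (thr k n : ℝ) / 2 := by linarith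
  have hTN : T ≤ ((n.choose 2 : ℕ) : ℝ) / 6 := by
    have := mul_le_mul_of_nonneg_left hn6.le hNr.le
    rw [hTdef]; linarith
  refine ⟨?_, ?_, ?_, ?_⟩
  · have : ((2 * K + 2 : ℕ) : ℝ) ≤ j := by push_cast; linarith
    exact_mod_cast this
  · have : (4 * j : ℝ) ≤ ((n.choose 2 : ℕ) : ℝ) := by linarith
    exact_mod_cast this
  · linarith
  · have : (K : ℝ) ≤ (thr k n : ℝ) / 4 := by linarith
    linarith

/-- **Ratio of slice sizes**: `C(N, a + K) · a^K ≤ C(N, a) · N^K`. [folklore] -/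
theorem choose_add_mul_pow_le (N a K : ℕ) : N.choose (a + K) * a ^ K ≤ N.choose a * N ^ K := by
  induction K with
  | zero => simp
  | succ K ih =>
    have hstep : N.choose (a + K + 1) * (a + K + 1) = N.choose (a + K) * (N - (a + K)) :=
      Nat.choose_succ_right_eq N (a + K)
    calc N.choose (a + (K + 1)) * a ^ (K + 1)
        = N.choose (a + K + 1) * a * a ^ K := by rw [← add_assoc, pow_succ]; ring
      _ ≤ N.choose (a + K + 1) * (a + K + 1) * a ^ K :=
          Nat.mul_le_mul_right _ (Nat.mul_le_mul_left _ (by omega))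
      _ = N.choose (a + K) * (N - (a + K)) * a ^ K := by rw [hstep]
      _ ≤ N.choose (a + K) * N * a ^ K := Nat.mul_le_mul_right _ (Nat.mul_le_mul_left _ (Nat.sub_le _ _))
      _ = (N.choose (a + K) * a ^ K) * N := by ring
      _ ≤ (N.choose a * N ^ K) * N := Nat.mul_le_mul_right _ ih
      _ = N.choose a * N ^ (K + 1) := by rw [pow_succ]; ring

/-- The ratio of consecutive-window slice sizes in real form: `#slice_{a+K} · a^K ≤ #slice_a · C(n,2)^K`. [folklore] -/
theorem card_slice_add_mul_pow_le (n a K : ℕ) :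
    (#(slice n (a + K)) : ℝ) * (a : ℝ) ^ K ≤ #(slice n a) * ((n.choose 2 : ℕ) : ℝ) ^ K := by
  rw [Summit.PneNP.PneNP.Cruxes.ConstantBand.FlatPriorRelativeMinterms.ts_card_slice,
    Summit.PneNP.PneNP.Cruxes.ConstantBand.FlatPriorRelativeMinterms.ts_card_slice]
  exact_mod_cast choose_add_mul_pow_le (n.choose 2) a K

/-- **The sprinkle tail is eventually small**: for `k ≥ 2`, `δ₁ > 0`, `θ = δ₁/(2(k-1))` and `ε > 0`, eventually
`8 · (n²)^θ · n^{-2δ₁/(k-1)} ≤ ε`. [folklore] -/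
theorem forcing_tail_eventually {k : ℕ} (hk : 2 ≤ k) {δ₁ ε : ℝ} (hδ₁ : 0 < δ₁) (hε : 0 < ε) :
    ∀ᶠ n : ℕ in atTop, 8 * ((n : ℝ) ^ (2 : ℝ)) ^ (δ₁ / (2 * ((k : ℝ) - 1))) *
      (n : ℝ) ^ (-(2 * δ₁) / ((k : ℝ) - 1)) ≤ ε := by
  have hk1 : (0 : ℝ) < (k : ℝ) - 1 := by
    have : (2 : ℝ) ≤ k := by exact_mod_cast hk
    linarith
  have hc : 0 < δ₁ / ((k : ℝ) - 1) := div_pos hδ₁ hk1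
  filter_upwards [eventually_mul_rpow_neg_lt hc hε 8, eventually_gt_atTop 0] with n hn hn0
  have hnr : (0 : ℝ) < n := by exact_mod_cast hn0
  have : 8 * ((n : ℝ) ^ (2 : ℝ)) ^ (δ₁ / (2 * ((k : ℝ) - 1))) * (n : ℝ) ^ (-(2 * δ₁) / ((k : ℝ) - 1)) =
      8 * (n : ℝ) ^ (-(δ₁ / ((k : ℝ) - 1))) := by
    rw [← Real.rpow_mul hnr.le, mul_assoc, ← Real.rpow_add hnr]
    congr 2
    field_simp
    ring
  rw [this]
  exact hn.le

/-- **Registered form** (sub-goal `forcing_window_pkg` of stmt-PneNP-14083): the window package, `k` explicit.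
[folklore] -/
theorem forcing_window_pkg :
    ∀ k : ℕ, 3 ≤ k → ∀ᶠ n : ℕ in atTop, 0 < n.choose 2 ∧ 2 * k ≤ n ∧ ∀ j : ℕ, Central k n j →
      2 * k.choose 2 + 2 ≤ j ∧ 4 * j ≤ n.choose 2 ∧
      (j : ℝ) ≤ 2 * (((n.choose 2 : ℕ) : ℝ) * (n : ℝ) ^ (-(2 : ℝ) / ((k : ℝ) - 1))) ∧
      ((n.choose 2 : ℕ) : ℝ) * (n : ℝ) ^ (-(2 : ℝ) / ((k : ℝ) - 1)) ≤ 8 * ((j : ℝ) - k.choose 2) :=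
  fun _ hk => forcing_window hk

end Summit.PneNP.PneNP.Theorems.ShallowSliceBound

end
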